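import Summits.BirchSwinnertonDyer.Rank1Residual.X11b.Three.HsiehDescentOfRangeReciprocity
import Literature.NumberTheory.EllipticCurves.CyclotomicZpExtension
import Literature.NumberTheory.PAdicHodge.TateSenCharacterInvariants
import HarnessLib

/-!
# Route `ClassRecordThree`, crux `HsiehDescentAtThree` (item stmt-BirchSwinnertonDyer-19108) — PART 1 of 2:
# the Tate–Sen input in its PRINTED shape and the vanishing of the twist exponent on inertia

Cell `bsd-stepL` (run/shared/lean/pub/bsd-stepL/), seat `bsd-stepL-bdp` (prover g9; kernel text = g4's HOME file
`bdp/K4ter_Proof.lean` v3 §§1, 4, re-checked rc 0 on 2026-08-26 and re-cut for the tree under D-0059 ∕ D-0071),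
`--supports stmt-BirchSwinnertonDyer-19108` (route `route-BirchSwinnertonDyer-ClassRecordThree`, crux 4 = the named
descent residual `Three.HsiehDescentAt₃ W` of H1@3). TARGET.md v1.33 §1.1 H1@3: kernel price of record =
{ONE printed theorem in its printed shape (Tate–Sen for a character, Brinon–Conrad Thm 2.2.7) + K5-B}; this file and
its sequel `ClassRecordThreeHsiehDescentOfOpenReciprocity` put exactly that reduction in the tree. Nothing is
discharged; the node `Three.HsiehDescentAt₃`, K3, K4″ are untouched; no census word changes (T7).

## What this file does

* input: the NAMED FACT `Literature.NumberTheory.PAdicHodge.TateSenCharacterVanishing p` (tree file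
  `Literature/NumberTheory/PAdicHodge/TateSenCharacterInvariants.lean`, filed with this one): Tate–Sen vanishing
  `ℂ_p(η)^{G_F} = 0` for the unramified local field `F = ℚ_p(μ_m)` (`p ∤ m`; `G_F = {τ | τ fixes μ_m}` acting on `ℂ_p`
  through the continuous extensions `T τ`) and a `ℤ_p^×`-valued character `η` of `G_F` whose image on the INERTIA
  group `{τ | τ fixes every root of unity of order prime to p}` is infinite — [BrinonConrad2009, Thm. 2.2.7] =
  [Tate1967, §3.3 Thm. 2], the character case of the tree's named fact `Literature.NumberTheory.PAdicHodge.SenFiniteness`;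
  K3's vocabulary (`X11b/PadicSemiInvariant.lean`: Mathlib's `PadicAlgCl p`, `ℂ_[p]`, the Krull topology).
* `tateSenShape_of_tateSenCharacterVanishing` — the printed fact implies K3's «semi-invariant SHAPE» on `G_F` (PROVED:
  base point `w = 1 + p^{e+1}`, character `ψ = PadicOneUnits.oneAddPow p e` — continuous and injective for
  `e + 3 ≤ p (e + 1)` —, `η := (1 + p^{e+1})^{a(·)}`; if `a(τ₀) ≠ 0` at one inertial `τ₀` then
  `η(τ₀^n) = (1+p^{e+1})^{n a(τ₀)}` are pairwise distinct, so `η` has infinite image on inertia and the printed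
  theorem kills the period — contradiction).
* `twistExponent_eq_zero_on_inertia_of_tateSenCharacter` — the twin of the tree's
  `RangeTransport.twistExponent_eq_zero_of_inertia` (K4″ step 5) with every quantifier restricted to `G_F`: if
  `E ≠ 0` in `𝓞_{ℂ_p}⟦T⟧` carries twist relations `T_τ Ē = d(τ)·B_{a(τ)}·Ē` for all `τ ∈ G_F`, then `a = 0` on inertia
  (`twist_mul` ∕ `twist_unique` ⇒ additivity on `G_F`; the two-coefficient formula ⇒ continuity on `G_F`;
  `twist_divXPowOrder` + `twist_period` ⇒ the periods; then the shape).

HONEST FRAMING: a CONDITIONAL reduction; `TateSenCharacterVanishing 3` is a hypothesis wherever used. What this is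
NOT: not a proof of Tate–Sen (a tree proof would need Sen theory ∕ normalised traces for a non-cyclotomic
`ℤ_p`-extension — the tree's `TateTwistInvariants` covers cyclotomic twists only, and `i ∉ ℚ₃` forces
`[ℚ₃(μ_m):ℚ₃] ≥ 2`, PROOF-BDP §19.2); not K5-B; not a change of any node or census word.

References: [Tate1967] J. Tate, *p-divisible groups* (Driebergen 1966), Springer 1967, §3.3 Thms 1–2;
[BrinonConrad2009] O. Brinon, B. Conrad, *CMI notes on p-adic Hodge theory*, Thm. 2.2.7; [Serre1973] J.-P. Serre,
*A course in arithmetic*, Ch. II §3; tree `X11b/PadicSemiInvariant.lean` (K3), `X11b/Three/HsiehDescentInertia.lean` §4,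
`X11b/Three/HsiehDescentOfRangeReciprocity.lean` (K4″); cell memo PROOF-BDP v1.7 §18 (3), §19.2, §19.8, §19.10.
-/

noncomputable section

open scoped NumberField Topology
open Filter NumberField IsDedekindDomain Field PowerSeries WeierstrassCurve
open Literature.NumberTheory.GaloisRepresentations Literature.NumberTheory.EllipticCurves
open Literature.NumberTheory.EllipticCurves.ModularForms
open Summit.BirchSwinnertonDyer.Rank1Residual Summit.BirchSwinnertonDyer.Rank1Residual.X11b
open Summit.BirchSwinnertonDyer.Rank1Residual.X11b.Three
open Summit.BirchSwinnertonDyer.Rank1Residual.X11b.LambdaSupply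
open Summit.BirchSwinnertonDyer.Rank1Residual.X11b.Three.LambdaSupply
open Summit.BirchSwinnertonDyer.Rank1Residual.X11b.PadicComplexTransport (continuous_algEquiv
  mem_unrIntegers_of_forall_inertia_fixed_family mem_fracUnr_of_forall_inertia_fixed_family)
open Summit.BirchSwinnertonDyer.Rank1Residual.X11b.Three.RangeTransport
open Literature.NumberTheory.PAdicHodge (TateSenCharacterVanishing)

namespace Summit.BirchSwinnertonDyer.BirchSwinnertonDyer.Theorems

section TateSen

variable {p : ℕ} [Fact p.Prime]

/-! ### §1 The printed fact implies K3's semi-invariant SHAPE on `G_F = {τ | τ fixes μ_m}` -/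

open Literature.NumberTheory.EllipticCurves.PadicOneUnits in
/-- **K3's semi-invariant shape on `G_F` from the printed Tate–Sen theorem.** For `0 < m`, `p ∤ m`, a family `T τ` of
continuous extensions, and `a : Gal(ℚ̄_p/ℚ_p) → ℤ_p` additive and continuous on `G_F = {τ | τ fixes μ_m}`: if every
rational base point `w` near `1` and every continuous `ψ : ℤ_p → ℂ_pˣ` with `ψ(1) = w` admit `q ≠ 0` with
`T τ q = ψ(a τ) q` for all `τ ∈ G_F`, then `a` vanishes on INERTIA. Proof: take `w = 1 + p^{e+1}` with
`p^{-(e+1)} < δ` and `ψ = (1 + p^{e+1})^{(·)}` (tree `PadicOneUnits.oneAddPow`, continuous and injective); then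
`η := (1 + p^{e+1})^{a(·)}` is a norm-one `ℤ_p`-valued character on `G_F` and the period is a semi-invariant for it;
if `a(τ₀) ≠ 0` for an inertial `τ₀`, the values `η(τ₀^n)` are pairwise distinct, so `η` has infinite image on
inertia and `TateSenCharacterVanishing p` forces `q = 0` — contradiction. [cite: BrinonConrad2009, Thm. 2.2.7]
[cite: Serre1973, Ch. II §3.2 Prop. 8] -/
theorem tateSenShape_of_tateSenCharacterVanishing (h : TateSenCharacterVanishing p) {m : ℕ} (hm : 0 < m)
    (hpm : ¬ p ∣ m) (T : (PadicAlgCl p ≃ₐ[ℚ_[p]] PadicAlgCl p) → ℂ_[p] →+* ℂ_[p])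
    (hT : ∀ τ, Continuous (T τ)) (hTτ : ∀ τ (x : PadicAlgCl p), T τ x = τ x)
    (a : (PadicAlgCl p ≃ₐ[ℚ_[p]] PadicAlgCl p) → ℤ_[p])
    (hadd : ∀ τ₁ τ₂, (∀ ζ : PadicAlgCl p, ζ ^ m = 1 → τ₁ ζ = ζ) → (∀ ζ : PadicAlgCl p, ζ ^ m = 1 → τ₂ ζ = ζ) →
      a (τ₁ * τ₂) = a τ₁ + a τ₂)
    (hcont : ContinuousOn a {τ | ∀ ζ : PadicAlgCl p, ζ ^ m = 1 → τ ζ = ζ})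
    (hper : ∃ δ : ℝ, 0 < δ ∧ ∀ (w : ℚ_[p]) (ψ : Multiplicative ℤ_[p] →* ℂ_[p]ˣ), Continuous ψ →
        ((ψ (Multiplicative.ofAdd 1) : ℂ_[p]ˣ) : ℂ_[p]) = algebraMap ℚ_[p] ℂ_[p] w →
        ‖algebraMap ℚ_[p] ℂ_[p] w - 1‖ < δ →
        ∃ q : ℂ_[p], q ≠ 0 ∧ ∀ τ, (∀ ζ : PadicAlgCl p, ζ ^ m = 1 → τ ζ = ζ) →
          T τ q = ((ψ (Multiplicative.ofAdd (a τ)) : ℂ_[p]ˣ) : ℂ_[p]) * q) :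
    ∀ τ₀, (∀ ζ : PadicAlgCl p, (∃ k : ℕ, 0 < k ∧ ¬ p ∣ k ∧ ζ ^ k = 1) → τ₀ ζ = ζ) → a τ₀ = 0 := by
  intro τ₀ hτ₀
  obtain ⟨δ, hδ, hper⟩ := hper
  by_contra ha0
  have hp : p.Prime := Fact.out
  -- the base point `w = 1 + p^{e+1}` with `‖w - 1‖ < δ`, `e ≥ 1`
  have hp1 : ((p : ℝ)⁻¹) < 1 := inv_lt_one_of_one_lt₀ (by exact_mod_cast hp.one_lt)
  have hp0 : 0 ≤ ((p : ℝ)⁻¹) := by positivity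
  obtain ⟨n, hn⟩ := exists_pow_lt_of_lt_one hδ hp1
  set e : ℕ := max n 1 with he_def
  have he1 : 1 ≤ e := le_max_right _ _
  have he' : e + 3 ≤ p * (e + 1) := by
    have h2 : 2 ≤ p := hp.two_le
    nlinarith
  have hlt : ((p : ℝ)⁻¹) ^ (e + 1) < δ :=
    lt_of_le_of_lt (pow_le_pow_of_le_one hp0 hp1.le (by omega)) hn
  set q : ℤ_[p] := (p : ℤ_[p]) ^ (e + 1) with hq
  set w : ℚ_[p] := ((1 + q : ℤ_[p]) : ℚ_[p]) with hw_def
  have hw : ‖algebraMap ℚ_[p] ℂ_[p] w - 1‖ < δ := by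
    rw [norm_sub_rev, ← norm_neg, neg_sub, ← map_one (algebraMap ℚ_[p] ℂ_[p]), ← map_sub,
      norm_algebraMap', hw_def, PadicInt.coe_add, PadicInt.coe_one, add_sub_cancel_left,
      PadicInt.padic_norm_e_of_padicInt, hq, norm_pow, PadicInt.norm_p]
    exact hlt
  -- the character `ψ = (1+q)^{(·)}` into `ℂ_pˣ`
  set g : Multiplicative ℤ_[p] →* ℂ_[p] :=
    (((algebraMap ℚ_[p] ℂ_[p]).toMonoidHom.comp PadicInt.Coe.ringHom.toMonoidHom).comp
      (oneAddPow p e).toMonoidHom) with hg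
  have hg_apply : ∀ y : Multiplicative ℤ_[p],
      g y = algebraMap ℚ_[p] ℂ_[p] ((oneAddPow p e y.toAdd : ℤ_[p]) : ℚ_[p]) := fun y ↦ rfl
  have hgc : Continuous g := by
    have : (g : Multiplicative ℤ_[p] → ℂ_[p]) =
        fun y ↦ algebraMap ℚ_[p] ℂ_[p] ((oneAddPow p e y.toAdd : ℤ_[p]) : ℚ_[p]) := funext hg_apply
    rw [this]
    exact (isometry_padicInt_padicComplex (p := p)).continuous.comp
      ((continuous_oneAddPow e).comp continuous_toAdd)
  set ψ : Multiplicative ℤ_[p] →* ℂ_[p]ˣ := g.toHomUnits with hψ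
  have hψval : ∀ y, ((ψ y : ℂ_[p]ˣ) : ℂ_[p]) = g y := fun y ↦ rfl
  have hψc : Continuous ψ := by
    refine Units.continuous_iff.2 ⟨?_, ?_⟩
    · have : (Units.val ∘ ⇑ψ) = ⇑g := funext fun y ↦ rfl
      rw [this]; exact hgc
    · have : (fun y : Multiplicative ℤ_[p] ↦ ((ψ y)⁻¹ : ℂ_[p]ˣ).val) = fun y ↦ g y⁻¹ := by
        funext y; rw [← map_inv]; rfl
      rw [this]
      exact hgc.comp continuous_inv
  have hψ1 : ((ψ (Multiplicative.ofAdd 1) : ℂ_[p]ˣ) : ℂ_[p]) = algebraMap ℚ_[p] ℂ_[p] w := by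
    rw [hψval, hg_apply, toAdd_ofAdd, oneAddPow_one]
  -- the period
  obtain ⟨x, hx0, hx⟩ := hper w ψ hψc hψ1 hw
  -- the `ℤ_p`-valued character `η = (1+q)^{a(·)}`
  set η : (PadicAlgCl p ≃ₐ[ℚ_[p]] PadicAlgCl p) → ℤ_[p] := fun τ ↦ oneAddPow p e (a τ) with hη
  have hηmul : ∀ τ₁ τ₂, (∀ ζ : PadicAlgCl p, ζ ^ m = 1 → τ₁ ζ = ζ) →
      (∀ ζ : PadicAlgCl p, ζ ^ m = 1 → τ₂ ζ = ζ) → η (τ₁ * τ₂) = η τ₁ * η τ₂ := by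
    intro τ₁ τ₂ h₁ h₂
    simp only [hη, hadd τ₁ τ₂ h₁ h₂, AddChar.map_add_eq_mul]
  have hηcont : ContinuousOn η {τ | ∀ ζ : PadicAlgCl p, ζ ^ m = 1 → τ ζ = ζ} :=
    (continuous_oneAddPow e).comp_continuousOn hcont
  have hηnorm : ∀ τ, (∀ ζ : PadicAlgCl p, ζ ^ m = 1 → τ ζ = ζ) → ‖η τ‖ = 1 :=
    fun τ _ ↦ norm_oneAddPow e (a τ)
  -- additivity on powers of `τ₀`
  have hτ₀U : ∀ ζ : PadicAlgCl p, ζ ^ m = 1 → τ₀ ζ = ζ := fun ζ hζ ↦ hτ₀ ζ ⟨m, hm, hpm, hζ⟩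
  have hpowI : ∀ k : ℕ, ∀ ζ : PadicAlgCl p, (∃ k' : ℕ, 0 < k' ∧ ¬ p ∣ k' ∧ ζ ^ k' = 1) → (τ₀ ^ k) ζ = ζ := by
    intro k
    induction k with
    | zero => intro ζ _; rw [pow_zero]; rfl
    | succ k ih => intro ζ hζ; rw [pow_succ, AlgEquiv.mul_apply, hτ₀ ζ hζ, ih ζ hζ]
  have ha1 : a 1 = 0 := by
    have := hadd 1 1 (fun _ _ ↦ rfl) (fun _ _ ↦ rfl)
    rw [mul_one] at this
    -- `a 1 = a 1 + a 1`
    have h2 : a 1 + a 1 = a 1 + 0 := by rw [add_zero]; exact this.symm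
    exact add_left_cancel h2
  have hapow : ∀ k : ℕ, a (τ₀ ^ k) = (k : ℤ_[p]) * a τ₀ := by
    intro k
    induction k with
    | zero => rw [pow_zero, ha1, Nat.cast_zero, zero_mul]
    | succ k ih =>
      rw [pow_succ, hadd _ _ (fun ζ hζ ↦ hpowI k ζ ⟨m, hm, hpm, hζ⟩) hτ₀U, ih, Nat.cast_succ]
      ring
  have hηinf : (η '' {τ | ∀ ζ : PadicAlgCl p, (∃ k : ℕ, 0 < k ∧ ¬ p ∣ k ∧ ζ ^ k = 1) → τ ζ = ζ}).Infinite := by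
    have hinj : Function.Injective fun k : ℕ ↦ η (τ₀ ^ k) := by
      intro k k' hkk'
      have h1 : (k : ℤ_[p]) * a τ₀ = (k' : ℤ_[p]) * a τ₀ := by
        have := oneAddPow_injective e he' (by simpa only [hη, hapow] using hkk')
        exact this
      have h2 : (k : ℤ_[p]) = (k' : ℤ_[p]) := mul_right_cancel₀ ha0 h1
      exact_mod_cast h2
    exact Set.infinite_of_injective_forall_mem hinj fun k ↦ ⟨τ₀ ^ k, hpowI k, rfl⟩
  -- the period is a semi-invariant for `η` on `G_F`
  have hx' : ∀ τ, (∀ ζ : PadicAlgCl p, ζ ^ m = 1 → τ ζ = ζ) →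
      T τ x = algebraMap ℚ_[p] ℂ_[p] ((η τ : ℤ_[p]) : ℚ_[p]) * x := by
    intro τ hτ
    rw [hx τ hτ, hψval, hg_apply, toAdd_ofAdd]
  exact hx0 (h m hm hpm T hT hTτ η hηmul hηcont hηnorm hηinf x hx')

/-! ### §2 The twist exponent dies on inertia — version on `G_F` (twin of `RangeTransport.twistExponent_eq_zero_of_inertia`) -/

/-- **The twist exponent vanishes on inertia, given twist relations on `G_F = {τ | τ fixes μ_m}` and the printed
Tate–Sen theorem.** Let `0 < m`, `p ∤ m`, and let `E ≠ 0` in `𝓞_{ℂ_p}⟦T⟧` carry, for every `τ ∈ G_F` (continuous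
extensions `T_τ`), a twist relation `T_τĒ = d(τ)·B_{a(τ)}·Ē` with `d(τ) ≠ 0`. Then `a` is additive and continuous ON
`G_F` (`twist_mul` ∕ `twist_unique`; the two-coefficient formula of `continuous_twistExponent` on the subset), the
periods of `twist_period` (whose rational base points every `T_τ` fixes) are semi-invariants on `G_F`
(`twist_divXPowOrder`), so the shape `tateSenShape_of_tateSenCharacterVanishing` forces `a(τ) = 0` for every INERTIAL
`τ`. = the tree's `twistExponent_eq_zero_of_inertia` with every quantifier restricted to `G_F` and K3's `hSen`
replaced by the printed fact. [cite: BrinonConrad2009, Thm. 2.2.7] [cite: Tate1967, §3.3 Theorem 2]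
[cite: Washington1997, §5.1] -/
theorem twistExponent_eq_zero_on_inertia_of_tateSenCharacter (hTS : TateSenCharacterVanishing p) {m : ℕ}
    (hm : 0 < m) (hpm : ¬ p ∣ m)
    (T : (PadicAlgCl p ≃ₐ[ℚ_[p]] PadicAlgCl p) → ℂ_[p] →+* ℂ_[p])
    (hT : ∀ τ, Continuous (T τ)) (hTτ : ∀ τ (x : PadicAlgCl p), T τ x = τ x)
    {E : PowerSeries 𝓞_ℂ_[p]} (hE : E ≠ 0) {a : (PadicAlgCl p ≃ₐ[ℚ_[p]] PadicAlgCl p) → ℤ_[p]}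
    {d : (PadicAlgCl p ≃ₐ[ℚ_[p]] PadicAlgCl p) → ℂ_[p]} (hd : ∀ τ, d τ ≠ 0)
    (h : ∀ τ, (∀ ζ : PadicAlgCl p, ζ ^ m = 1 → τ ζ = ζ) → (E.map (PadicComplexInt p).subtype).map (T τ) =
      C (d τ) * ((((binomialSeries ℤ_[p] (a τ)).map (R1.toCpInt p)) * E).map
        (PadicComplexInt p).subtype)) :
    ∀ τ, (∀ ζ : PadicAlgCl p, (∃ k : ℕ, 0 < k ∧ ¬ p ∣ k ∧ ζ ^ k = 1) → τ ζ = ζ) → a τ = 0 := by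
  -- the subgroup `G_F`
  set P : (PadicAlgCl p ≃ₐ[ℚ_[p]] PadicAlgCl p) → Prop := fun τ ↦ ∀ ζ : PadicAlgCl p, ζ ^ m = 1 → τ ζ = ζ
    with hPdef
  have hP1 : P 1 := fun _ _ ↦ rfl
  have hPmul : ∀ τ₁ τ₂, P τ₁ → P τ₂ → P (τ₁ * τ₂) := fun τ₁ τ₂ h₁ h₂ ζ hζ ↦ by
    rw [AlgEquiv.mul_apply, h₂ ζ hζ, h₁ ζ hζ]
  change ∀ τ, P τ → _ at h
  -- `a` is additive on `P`
  have hmul : ∀ τ₁ τ₂, P τ₁ → P τ₂ → a (τ₁ * τ₂) = a τ₁ + a τ₂ := by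
    intro τ₁ τ₂ h₁ h₂
    have h12 := twist_mul (hTτ τ₁) (h τ₁ h₁) (h τ₂ h₂)
    have hT12 : T (τ₁ * τ₂) = (T τ₁).comp (T τ₂) :=
      extension_mul (hT τ₁) (hTτ τ₁) (hT τ₂) (hTτ τ₂) (hT _) (hTτ _)
    have h' : (E.map (PadicComplexInt p).subtype).map (T (τ₁ * τ₂)) =
        ((E.map (PadicComplexInt p).subtype).map (T τ₂)).map (T τ₁) := by
      rw [hT12, map_comp, RingHom.comp_apply]
    rw [h (τ₁ * τ₂) (hPmul _ _ h₁ h₂), h12] at h'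
    exact (twist_unique hE (hd _) h').2
  -- `a` is continuous on `P`: a rational function of two orbits there
  have hcont : ContinuousOn a {τ | P τ} := by
    set F := E.map (PadicComplexInt p).subtype with hF
    have hF0 : F ≠ 0 := fun h0 ↦ hE (map_subtype_eq_zero_iff.1 h0)
    set m := F.order.toNat with hm
    set e₀ := coeff m F with he₀
    set e₁ := coeff (m + 1) F with he₁
    have he : e₀ ≠ 0 := coeff_order hF0
    have hid : ∀ τ, P τ → T τ e₀ = d τ * e₀ ∧
        T τ e₁ = d τ * (e₁ + algebraMap ℚ_[p] ℂ_[p] ((a τ : ℤ_[p]) : ℚ_[p]) * e₀) := by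
      intro τ hτ
      obtain ⟨h0, h1⟩ := coeff_order_binomialTwist_mul (a τ) F
      have hτ' := h τ hτ
      rw [map_mul] at hτ'
      refine ⟨?_, ?_⟩
      · have := congrArg (coeff m) hτ'
        rwa [coeff_map, coeff_C_mul, h0] at this
      · have := congrArg (coeff (m + 1)) hτ'
        rwa [coeff_map, coeff_C_mul, h1] at this
    have hTe : ∀ τ, T τ e₀ ≠ 0 := fun τ h0 ↦ by
      have : ‖e₀‖ = 0 := by rw [← norm_extension (hT τ) (hTτ τ) e₀, h0, norm_zero]
      exact he (norm_eq_zero.1 this)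
    have hformula : ∀ τ, P τ → algebraMap ℚ_[p] ℂ_[p] ((a τ : ℤ_[p]) : ℚ_[p]) =
        (T τ e₁ * e₀ - T τ e₀ * e₁) / (T τ e₀ * e₀) := by
      intro τ hτ
      obtain ⟨h0, h1⟩ := hid τ hτ
      rw [eq_div_iff (mul_ne_zero (hTe τ) he), h1, h0]
      ring
    have hcontF : Continuous fun τ ↦ (T τ e₁ * e₀ - T τ e₀ * e₁) / (T τ e₀ * e₀) :=
      (((continuous_orbit T hT hTτ e₁).mul continuous_const).sub
        ((continuous_orbit T hT hTτ e₀).mul continuous_const)).div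
        ((continuous_orbit T hT hTτ e₀).mul continuous_const) fun τ ↦ mul_ne_zero (hTe τ) he
    have hcont' : ContinuousOn (fun τ ↦ algebraMap ℚ_[p] ℂ_[p] ((a τ : ℤ_[p]) : ℚ_[p]))
        {τ | P τ} :=
      hcontF.continuousOn.congr fun τ hτ ↦ hformula τ hτ
    exact (isometry_padicInt_padicComplex (p := p)).isEmbedding.continuousOn_iff.2 hcont'
  -- the periods, on `E₁ = E / T^{ord E}`
  set E₁ := E.divXPowOrder with hE₁
  have he0 : ((constantCoeff E₁ : 𝓞_ℂ_[p]) : ℂ_[p]) ≠ 0 := by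
    intro h0
    have : constantCoeff E₁ = 0 := Subtype.ext h0
    exact hE (constantCoeff_divXPowOrder_eq_zero_iff.1 this)
  have h₁ : ∀ τ, P τ → (E₁.map (PadicComplexInt p).subtype).map (T τ) =
      C (d τ) * ((((binomialSeries ℤ_[p] (a τ)).map (R1.toCpInt p)) * E₁).map
        (PadicComplexInt p).subtype) := fun τ hτ ↦ twist_divXPowOrder (h τ hτ)
  refine tateSenShape_of_tateSenCharacterVanishing hTS hm hpm T hT hTτ a hmul hcont
    ⟨‖((constantCoeff E₁ : 𝓞_ℂ_[p]) : ℂ_[p])‖, norm_pos_iff.2 he0, fun w ψ hψc hψ1 hw ↦ ?_⟩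
  have hx1 : ‖algebraMap ℚ_[p] ℂ_[p] w - 1‖ < 1 :=
    hw.trans_le (R1.norm_coe_padicComplexInt_le_one p _)
  obtain ⟨v, hv⟩ := intSeries_exists_hasValueAt E₁ hx1
  refine ⟨v / ((constantCoeff E₁ : 𝓞_ℂ_[p]) : ℂ_[p]), ?_, fun τ hτ ↦ ?_⟩
  · exact div_ne_zero (twist_period (hT 1) (hTτ 1) (hd 1) (h₁ 1 hP1) hw hψc hψ1 hv).1 he0
  · exact (twist_period (hT τ) (hTτ τ) (hd τ) (h₁ τ hτ) hw hψc hψ1 hv).2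

end TateSen

end Summit.BirchSwinnertonDyer.BirchSwinnertonDyer.Theorems

end
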